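import Summits.QuantumFields.BalabanUV.T4Continuum.Spine.NE1p.DressedTowerWitnessSlice
import Summits.QuantumFields.BalabanUV.T4Continuum.Spine.NE1p.DressedTowerWitnessEnd
import Summits.QuantumFields.BalabanUV.T4Continuum.Spine.NE1p.DressedTransportAssembledModSliceWin
import Summits.QuantumFields.BalabanUV.T4Continuum.Spine.NE1p.DressedTransportAssembledModData

/-!
# T⁴ programme, spine estimate NE1′ (node O3b/H2) — FUNCTION-LEVEL NON-VACUITY OF THE ASSEMBLED SLICE-WINDOW FACE AT EVERY
# CUTOFF, part 2: the assembled slice-window END BY NAME on the datum, the leaf bundle with row W5's ONE `U`, END-B, the ROOT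
# (formalisation crew `b2b-balaban-t4-ne1p-formalise-*`, leaf seat 03, generation 2, row W7; own-initiative consistency item,
# NOT a crew estimate row)

Cell `pub-balaban`, sub-cell `t4`, BINDER-OWNERS row NE1′ (owner lineage t4-ne1p-p1).  ADDITIVE — imports part 1
`Spine/NE1p/DressedTowerWitnessSlice` (the datum: ONE schedule `Wm`, the live exponent `𝒬M`, `FnM`, the pairs), row W5 part 2
`Spine/NE1p/DressedTowerWitnessEnd` (the ONE `UW : UniformConstants`, `realBaseAt_W`), leaf-04's row S1e part 5
`Spine/NE1p/DressedTransportAssembledModSliceWin` (END-F′-mod-swin under a `WindowScheduleModWin`: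
`transportLeaf_assembled_mod_swin_of_schedule`) and leaf-01's `Spine/NE1p/DressedTransportAssembledModData` (the canonical size
recursion `aszRec`) ONLY; modifies nothing.  One namespace with part 1.

CONTENTS.  §5 the remaining displayed binders of `transportLeaf_assembled_mod_swin_of_schedule Wm` on the datum: `exponentSliceAt_M`
((w2-act) for the ZERO action exponent on any direction window — a constant), the step budget `s1M` IN MODULUS FORM and the slice
sizes `AszM := aszRec …` (the END's two equality binders `hs1`∕`hAsz_*` hold by `rfl` ∕ leaf-01's lemmas), the (I4′) links `hδfM`
(`δf_k = ψ^{k+1}∕4 ≤ ½·ψ^k`), `hδfwkM` (`≤ wc k = ψ^{k+1}∕2`), `hdefwkM`∕`hrateM` (defect `ψ^{k+1}∕2`), `hSgM` (the live generation is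
the family's own generation `0`), `hcmM` (`‖c₀‖ = ¼ ≤ m = ¼` — the cutoff-free source condition with EQUALITY), (w4) `hdomM`
(`hdom_cell` on the CONSTANT ratio `hratioM`).  §6 **`htrM K := transportLeaf_assembled_mod_swin_of_schedule Wm …`** — the ASSEMBLED
slice-window transport leaf BY NAME at EVERY cutoff with all its displayed binders discharged (`hsl` at the per-step slice window by
`birthSlice_anti_window`, `hpairx := relGauge_pairs`, `hQ := hQM`, `hFn := FnM_succ`, …; F-4 `hP` is PRODUCED inside the END, not
displayed); **`leavesM K : BookingLeaves UW (BM K) (TM K)`** by row S3's `bookingLeavesCell` with row W5's `UW` (ONE `U` for BOTH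
faces and every cutoff); `classAt_towerM` (class + every dressed budget gate, `m = ¼ > 0`); **`dressedStability_towerM :
DressedStability towerM`** by `dressedStability_of_cell`.

HONEST FRAMING.  A decided toy: [folklore] kernel mathematics, 0 sorry, 0 citations, no `def … : Prop`; NOTHING of Bałaban's
densities or of [Balaban1989LargeFieldII] (1.71)–(1.75) pp. 379–380 is modelled or asserted.  VALUE = a joint-satisfiability
certificate, UNIFORM IN THE CUTOFF, for the ASSEMBLED slice-window binder family (H2 dictionary with a live generation, (I4′) links,
per-step cross-family margins, END-B's per-cutoff leaves) with ONE K-free `U` and ONE cutoff-free schedule; DEGENERATE WHERE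
DECLARED: action exponent `𝒜 ≡ 0` (rows W1∕W2 carry non-trivial action weights at K = 2), `rel = Eq`, no regeneration.  Headline
(c4): «the assembled slice-window binder SHAPES jointly inhabited at every cutoff by one K-free `U` — non-vacuity, nothing of
Bałaban's densities; NE1′ NOT proved; walls (w1)–(w7) unchanged».  Rung (B)+1 on ONE finite four-torus — NOT infinite volume, NOT a
mass gap, NOT OS on ℝ⁴, NOT Clay, NOT summit progress; spine PROVED 0∕9.  HONEST DEPENDENCY: continuum YM on T⁴ ⇐ BetaPertH ∧ nine
spine estimates (0/9 proved); BetaPertH ⇐ (D1) ∧ (D4) ∧ CAP+tail; G-an2-4 gates asym, D1 and NE2/3/4.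
-/

noncomputable section

namespace Summit.QuantumFields.BalabanUV.T4Continuum.NE1p.DressedTowerWitnessSlice

open MeasureTheory Set Metric Filter Finset
open scoped BigOperators
open Literature.MathematicalPhysics.QuantumFieldTheory.Balaban1983to89
open Literature.MathematicalPhysics.QuantumFieldTheory.Balaban1983to89.T4TermFormat
open Literature.MathematicalPhysics.QuantumFieldTheory.Balaban1983to89.T4TermFormat.Booking
open Literature.MathematicalPhysics.QuantumFieldTheory.Balaban1983to89.T4GatedBooking
open Literature.MathematicalPhysics.QuantumFieldTheory.Balaban1983to89.T4TrajectoryComparison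
open T4TrajectoryModulus (bondBall bondBall_add_mem bondBall_latMove_add_mem bondBall_diam)
open T4BlockTransport (Fld NDir latMove latN Site norm_dir_le)
open T4BirthChartTransport (GaugeInvariant BirthSlice RelGauge)
open T4TrajectoryDensity
open Summit.QuantumFields.BalabanUV.T4Continuum.T4TrajectoryDensityDressed
open Summit.QuantumFields.BalabanUV.T4Continuum.T4TrajectoryDensityWitness
open Summit.QuantumFields.BalabanUV.T4Continuum.NE1p.DressedRoot
open Summit.QuantumFields.BalabanUV.T4Continuum.NE1p.DressedUniformConstants
open Summit.QuantumFields.BalabanUV.T4Continuum.NE1p.DressedWindowScheduleWin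
open Summit.QuantumFields.BalabanUV.T4Continuum.NE1p.DressedWindowScheduleModWin
open Summit.QuantumFields.BalabanUV.T4Continuum.NE1p.DressedTowerWitness
open Summit.QuantumFields.BalabanUV.T4Continuum.NE1p.DressedTransportAssembledModData
open Summit.QuantumFields.BalabanUV.T4Continuum.NE1p.DressedTransportAssembledModSliceWin

/-! ## §5 The remaining displayed binders of the assembled slice-window END on the datum [folklore] -/

/-- `hE` (w2-act) on ANY direction window: the ZERO action exponent is holomorphic (constant) with oscillation `0`. [folklore] -/
theorem exponentSliceAt_M (a : Fld 4 ℂ) (S : Set (Fld 4 ℂ)) (w' ϱ : ℝ) :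
    ExponentSliceAt (fun U : Fld 4 ℂ => U) zeroExp (flAt a) latMove latN S w' ϱ 0 := fun _ _ _ _ _ =>
  ⟨univ, isOpen_univ, fun _ _ => subset_univ _, fun _ _ => aesm_flAt a _,
    Eventually.of_forall fun _ => by simp only [zeroExp]; exact differentiableOn_const 0,
    Eventually.of_forall fun _ _ _ => by simp [zeroExp]⟩

/-- THE STEP BUDGET IN MODULUS FORM [data]: `s1 b k = ‖c₀‖·Σ_{p ∈ {(b,0)}} (4∕r·stepProd α p.2 k·gen p.1 p.2)·δf_k` — the END's
`hs1` then holds by `rfl`. [folklore] -/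
def s1M (K : ℕ) (b : (BM K).Birth) (k : ℕ) : ℝ :=
  ‖(((1 / 4 : ℝ)) : ℂ)‖ * ∑ p ∈ ({(b, 0)} : Finset ((BM K).Birth × ℕ)),
    (4 / (1 : ℝ) * stepProd (fun _ : ℕ => alphaCell (1 / 2)) p.2 k * (TM K).gen p.1 p.2) * dfW k

/-- THE SLICE SIZES [data]: leaf-01's plain recursion `aszRec` from the generation sizes, zero action margins and `s1M`. [folklore] -/
def AszM (K : ℕ) : (BM K).Birth → ℕ → ℕ → ℝ := aszRec (TM K).gen (fun _ _ => 0) (s1M K)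

/-- `hSg`: the live generation of the met component of `b` at every step is `(b, 0)` — a live family, born, not from the future. [folklore] -/
theorem hSgM (K : ℕ) : ∀ (k : ℕ) (b : (BM K).Birth), ∀ p ∈ ({(b, 0)} : Finset ((BM K).Birth × ℕ)),
    p.1 ∈ ({b} : Finset (BM K).Birth) ∧ (BM K).birthScale p.1 ≤ p.2 ∧ p.2 ≤ k := by
  intro k b p hp
  rw [Finset.mem_singleton] at hp
  subst hp
  exact ⟨Finset.mem_singleton_self _, le_rfl, Nat.zero_le _⟩

/-- `hδf` (I4′): the fresh defect `ψ^{k+1}∕4` is nonnegative and below `c_δ·ψ^{k−0} = ½·ψ^k`. [folklore] -/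
theorem hδfM (K : ℕ) : ∀ (k : ℕ) (b : (BM K).Birth), ∀ p ∈ ({(b, 0)} : Finset ((BM K).Birth × ℕ)),
    0 ≤ dfW k ∧ dfW k ≤ 1 / 2 * ((LW ^ 2)⁻¹) ^ (k - p.2) := by
  intro k b p hp
  rw [Finset.mem_singleton] at hp
  subst hp
  refine ⟨(dfW_pos k).le, ?_⟩
  show ((LW ^ 2)⁻¹) ^ (k + 1) / 4 ≤ 1 / 2 * ((LW ^ 2)⁻¹) ^ (k - 0)
  rw [Nat.sub_zero, pow_succ]
  have h0 : 0 ≤ ((LW ^ 2)⁻¹) ^ k := pow_nonneg psi_pos.le k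
  have h1 := psi_le_one
  nlinarith

/-- `hδfwk`: the fresh defect is below the live generation's current slice window `wc k = ψ^{k+1}∕2`. [folklore] -/
theorem hδfwkM (k : ℕ) : dfW k ≤ Wm.wc k := by
  rw [Wm_wc]; unfold dfW; rw [pow_succ]
  have h0 : 0 ≤ ((LW ^ 2)⁻¹) ^ k * (LW ^ 2)⁻¹ := by have := psi_pos; positivity
  nlinarith

/-- `hdefwk`: the transverse defect `ψ^{k+1}∕2` IS the step's chart window. [folklore] -/
theorem hdefwkM (k : ℕ) : defW (k + 1) ≤ Wm.wc k := by
  rw [Wm_wc]; unfold defW; rw [pow_succ]; exact le_of_eq (by ring)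

/-- `hrate` (I4′): the defect decays at the transport rate from any generation scale. [folklore] -/
theorem hrateM (k' k : ℕ) : defW (k + 1) ≤ 1 / 2 * ((LW ^ 2)⁻¹) ^ (k - k') := by
  unfold defW
  exact mul_le_mul_of_nonneg_left (pow_le_pow_of_le_one psi_pos.le psi_le_one (by omega)) (by norm_num)

/-- `hcm`: the cutoff-free source condition `‖c₀‖ ≤ m` — here with EQUALITY `¼ = ¼` (the dressed budget is active). [folklore] -/
theorem hcmM : ‖(((1 / 4 : ℝ)) : ℂ)‖ ≤ 1 / 4 := by
  rw [Complex.norm_real, Real.norm_eq_abs, abs_of_pos (by norm_num : (0 : ℝ) < 1 / 4)]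

/-- `hdom` (w4) DISCHARGED by the schedule's constant ratio (`hratioM`) through row S3's `hdom_cell`. [folklore] -/
theorem hdomM (K k : ℕ) (_hk : k + 1 ≤ (BM K).K) :
    Real.exp 3 * (1 + 4 * (2 * Wm.σ k) / Wm.ϱc k) ≤ (fun _ : ℕ => alphaCell (1 / 2)) k :=
  hdom_cell (Wm.hϱc k) (hratioM k)

/-! ## §6 The assembled slice-window END BY NAME, the bundle with W5's ONE `U`, END-B, the ROOT [folklore] -/

/-- **END-F′-mod-swin ON THE DATUM, AT EVERY CUTOFF** — leaf-04's `transportLeaf_assembled_mod_swin_of_schedule Wm …` BY NAME with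
every displayed binder discharged: births `hslM` (at the per-step slice window, `birthSlice_anti_window`), the live step law
`FnM_succ`, the dictionary `hQM`, the weights for the zero action exponent, the modulus budget `s1M`∕`AszM` by `rfl`∕`aszRec_*`, the
(I4′) links, the fresh pairs `relGauge_pairs`, attainment `hlinM`; F-4 `hP` is PRODUCED inside the END (`pertSlice_under_history_mod_swin`),
not displayed.  Conclusion: the transport leaf `htr` at `C = 4·½∕1`, rate `ψ·alphaCell ½`, gated by the dressed budget, `m = ¼`. [folklore] -/
theorem htrM (K : ℕ) :
    (TM K).TransportsFromVar (4 * (1 / 2) / 1) (fun i => (LW ^ 2)⁻¹ * (fun _ : ℕ => alphaCell (1 / 2)) i)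
      (budgetGate (TM K) (fun _ _ => 0) (1 / 4) (fun _ b => {b}) (4 * (1 / 2) / 1)
        (fun i => (LW ^ 2)⁻¹ * (fun _ : ℕ => alphaCell (1 / 2)) i)) :=
  transportLeaf_assembled_mod_swin_of_schedule Wm (T := TM K) (Fn := fun _ k' k => FnM K k' k)
    (rel := fun _ _ _ U U' => U = U') (ref := fun _ _ U => U) (base := fun _ _ => base₁) (𝒜 := fun _ _ => zeroExp)
    (𝒬 := fun _ k => 𝒬M K k) (q := fun _ _ _ => 0) (μ := fun _ k => flAt (atomW (k + 1))) (z₀ := fun _ _ => 0)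
    (z₁ := fun _ _ => 0) (defect := fun _ _ k => defW (k + 1)) (cδ := 1 / 2) (ψ := (LW ^ 2)⁻¹) (m := 1 / 4)
    (s := fun _ _ => 0) (s1 := s1M K) (α := fun _ : ℕ => alphaCell (1 / 2)) (Asz := AszM K) (S := fun _ b => {b})
    (Sg := fun _ b => {(b, 0)}) (c := fun _ _ => (((1 / 4 : ℝ)) : ℂ)) (δf := fun _ k _ => dfW k)
    (fun _ => alphaCell_nonneg (by norm_num)) one_pos (by norm_num) psi_pos.le
    (fun b k' _ _ _ => birthSlice_anti_window (hslM K b k') (Wm.hwcw k'))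
    (fun _ k' k _ _ _ _ U => FnM_succ K k' k U) (fun _ _ k _ _ _ _ _ => mem_bddClass_flAt _ _)
    (fun _ _ k _ _ _ _ => realBaseAt_W _ _) (fun _ _ k _ _ _ _ => exponentSliceAt_M _ _ _ _) (fun b k => hQM K b k)
    (hSgM K) (fun _ _ => rfl) (fun f k'' => aszRec_birth (TM K).gen (fun _ _ => 0) (s1M K) f k'')
    (fun f _ _ _ hk => aszRec_succ (TM K).gen (fun _ _ => 0) (s1M K) f hk) (fun _ _ => hcmM)
    (fun b k p hp => hδfM K k b p hp) (fun _ k _ _ => hδfwkM k) (fun _ k => hDμM k) (fun _ k => hz₁M k)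
    (fun _ _ k _ _ _ _ U₀ _ pd _ _ => (relGauge_pairs k).mono fun z hz t _ => hz (latMove U₀ pd t))
    (fun k hk => hdomM K k hk) (fun _ _ _ _ _ h => h ▸ rfl) (fun _ _ _ k _ => aesm_flAt _ _) (fun _ _ k => hdefwkM k)
    (fun _ k' k _ _ _ => hrateM k' k) (fun b k' k _ _ _ _ ε hε => hlinM K b k' k ε hε)

/-- **THE LEAF BUNDLE AT CUTOFF `K` WITH ROW W5's ONE `U`** — row S3's `bookingLeavesCell` with `htr := htrM K` (the assembled
slice-window END by name); ONE `UW` for the window face (W5) AND the assembled face (here), at every cutoff. [folklore] -/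
def leavesM (K : ℕ) : BookingLeaves UW (BM K) (TM K) :=
  bookingLeavesCell one_le_LW (by norm_num) le_rfl (by norm_num) zero_le_one zero_le_one (by norm_num) (locCell_LW _).le
    (by norm_num) (by norm_num) (fun _ => 0) (fun _ _ => 0) (fun _ b => {b}) (fun _ => le_rfl) (fun _ _ => le_rfl)
    (fun k _ _ _ => Nat.zero_le k) (hcountM K) (fun _ _ => by norm_num) (hbirthM K) (htrM K) (hregM K _)

/-- **END-B's PER-CUTOFF FACE ON THE DATUM**: the class AND every dressed budget gate along the trajectory, at every cutoff. [folklore] -/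
theorem classAt_towerM (K : ℕ) :
    ClassAt (BM K) UW.A₀ UW.ρ₁ UW.τ ∧ ∀ k, k ≤ (BM K).K → RanBelow (budgetGate (TM K) (leavesM K).s₀ UW.m (leavesM K).S UW.C
      (leavesM K).ρ) k :=
  classAt_of_bookingLeaves (leavesM K)

/-- **NON-VACUITY OF THE ROOT THROUGH THE ASSEMBLED SLICE-WINDOW PIPELINE, AT FUNCTION LEVEL, UNIFORMLY IN THE CUTOFF** [decided
toy]: `DressedStability towerM` by row S3's `dressedStability_of_cell` — ONE `U` (row W5's), ONE schedule, a live generation in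
the exponent at every step of every cutoff. [folklore] -/
theorem dressedStability_towerM : DressedStability towerM :=
  dressedStability_of_cell towerM one_le_LW (by norm_num) le_rfl (by norm_num) zero_le_one zero_le_one (by norm_num)
    (locCell_LW _).le (by norm_num) (by norm_num) fun _ K => leavesM K

end Summit.QuantumFields.BalabanUV.T4Continuum.NE1p.DressedTowerWitnessSlice

end
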